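import Literature.Computability.AlgebraicComplexity.DDS21DepthThreeDiagonalToolkit
import Literature.Computability.AlgebraicComplexity.UABPToolkit
import Literature.Computability.AlgebraicComplexity.BDI20NisanWidthProofs
import Literature.LinearAlgebra.Matrix.RankMinors
import HarnessLib

/-!
# Dutta–Dwivedi–Saxena 2021, Lemmas 2.22 / 2.23: de-bordering the read-once form
# (`\overline{Σ∧Σ} ⊆ ARO`, "ARO width is closed under approximation"), via Nisan's characterisation

Theorem-only companion (cell `val-lit`, row X2-DDS21, brick B2b) of
`DDS21DepthThreeDiagonalToolkit.lean` (B2) and `DDS21BorderDepthThree.lean`. Source: P. Dutta,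
P. Dwivedi, N. Saxena, *Demystifying the border of depth-3 algebraic circuits*, FOCS 2021, full
version `paper:galaxy-pdf-7641649743695546420` [DuttaDwivediSaxena2022]: **Lemma 2.9** (Nisan's
characterisation: an ARO of width `w` has coefficient spaces of dimension `≤ w`, p0019 L522–531),
**Lemma 2.10** (converse, p0020 L532–536), **Lemma 2.22** ("De-bordering ARO. Consider a polynomial
`f` which is approximated by ARO of size `s` over `𝔽(ε)[x]`. Then, there exists an ARO of size `s`
which exactly computes `f`", p0024 L644–660: "`q = f + εQ` computable by width `w` ARO over
`𝔽(ε)[x]` … the dimension of the coefficient space does not increase under limits … by Lemma 2.10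
there exists an ARO of width `w`"), **Lemma 2.23** ("De-bordering `Σ∧Σ∧`": `f` approximated by
`Σ∧Σ∧` of size `s` ⇒ `f` has an ARO of size `O(s n² D²)`, p0025 L661–664), as used in the base
step Claim 3.3 of the proof of Thm. 3.2 (p0027 L737–741: "`\overline{Σ∧Σ} ⊆ ARO`").

## Rendering (what is proved; no definitions, no named facts)

"ARO of width `w` in the order `x_0, …, x_{n-1}`" is rendered in TRANSFER-MATRIX form — the form in
which the source's Lemma 2.9/2.10 (Nisan 1991) is already a theorem of the tree for word tensors,
`BDI2020.hasNcABPWidthLE_iff_wordTTRank_le` (`BDI20NisanWidthProofs.lean`): a polynomial `f` of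
individual degree `≤ e` is identified with its **coefficient tensor**
`Ψ_f : (Fin n → Fin (e+1)) → F`, `Ψ_f(a) = coeff_{x^a} f`, and a width-`w` read-once oblivious
program with univariate edge labels `M_ℓ(x_ℓ) = Σ_c x_ℓ^c · C_ℓ[c]` computes `f = uᵀ M_0(x_0) ⋯
M_{n-1}(x_{n-1}) v` iff the transfer matrices `(C, u, v)` compute `Ψ_f` as a noncommutative ABP
(`BDI2020.HasNcABPWidthLE w Ψ_f`), by the expansion `polynomial_eq_transfer_of_coeff`.

* §A coefficients of a product of univariates in distinct variables (`prod_aeval_X_eq_sum_box`,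
  `coeff_box_prod_aeval_X`, `coeff_prod_aeval_X_eq_zero_of_lt`).
* §B **Lemma 2.9 direction for the read-once form**: the coefficient tensor of a sum of `T`
  products of univariates (the form produced from `Σ∧Σ` by `exists_sum_prod_univariate_of_mem_swsClass`,
  B2 §6) is computed by DIAGONAL transfer matrices of width `T`
  (`hasNcABPWidthLE_coeff_sum_prod_univariate`); hence all its Nisan flattenings have rank `≤ T`
  (tree: `BDI2020.Nisan.rank_wordFlattening_le_of_hasNcABPWidthLE`).
* §C **the limit step of Lemma 2.22** ("dimension of the coefficient space does not increase under
  limits"): if the word tensor over `𝔽(ε)` is the image of a tensor of POLYNOMIALS in `ε` whose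
  flattenings have rank `≤ s`, then the flattenings of the constant-term tensor have rank `≤ s`
  (`rank_wordFlattening_constantCoeff_le`: every `(s+1)`-minor is a polynomial in `ε` mapping to
  `0` in `𝔽(ε)`, hence `0`, hence its constant term is `0`; tree
  `Literature.LinearAlgebra.Matrix.rank_le_iff_det_submatrix_eq_zero`). The polynomial lift is
  exactly what `MS2021.IsEpsApprox f g` provides coefficientwise.
* §D **Lemma 2.10 direction + the read-once program**: from `HasNcABPWidthLE w Ψ_f` (Nisan's
  construction, tree) the explicit transfer-matrix program for `f` (`polynomial_eq_transfer_of_coeff`,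
  `prod_ofFn_sum_smul` — the ordered expansion of a product of sums of matrices).
* §E **Lemma 2.22 / 2.23 assembled**: `exists_transfer_of_isEpsApprox_sum_prod_univariate` (the
  read-once de-bordering for the explicit sum-of-products input: width does not grow) and
  `exists_transfer_of_mem_border_swsClass` — **`f ∈ \overline{Σ∧Σ(t,e)}` over `𝔽(ε)` ⇒ `f` has a
  width-`t·((n+1)e+1)` read-once oblivious program over `𝔽` with univariate labels of degree
  `≤ e`** (characteristic zero, from B2's duality step).
* §F (v2 append) **in the tree's ABP currency**: `UABPComputesLen.of_transferMatrices` — a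
  transfer-matrix (read-once / IMM-type) program `uᵀ M_0 ⋯ M_{n-1} v` with univariate `w × w`
  layers is ONE layered DAG on `(n+1)·w + 2` vertices in the sense of `DDS2021.UABPComputesLen`
  (`UABPToolkit.lean`, val-lit t18); hence ★ `uabpComputes_of_mem_border_swsClass`:
  **`f ∈ border (swsClass (RatFunc 𝔽) n t e) ⇒ UABPComputes ((n+1)·t((n+1)e+1) + e + 2) f`**
  (`\overline{Σ∧Σ} ⊆ ABP`, Lemma 2.23 + Claim 3.3's `P/Q` half), and
  `uabpComputes_of_isEpsApprox_sum_prod_univariate` (Lemma 2.22 for the diagonal read-once input);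
  (v3) the same with the LENGTH `n + 2` kept (`uabpComputesLen_of_mem_border_swsClass`,
  `uabpComputesLen_of_isEpsApprox_sum_prod_univariate`) and the one-parameter form
  `UABPComputesLen (s⁷) (n+2) f` for `t, e, n ≤ s`, `2 ≤ s` (`…_le`, the binder shape of
  `DDS2021_thm_3_2`).

Deviations / scope (disclosed): (i) the source's ARO allows ANY variable order and its "size";
here the order is the identity order `x_0, …, x_{n-1}` and the bookkept quantity is the WIDTH (the
size of the source's Lemma 2.23, `O(s n² D²)`, is the vertex count `≤ (n+1)·width + 2` of this
program); (ii) `Σ∧Σ` (B2's `swsClass`) rather than `Σ∧Σ∧`; (iii) coefficients in a FIELD `𝔽` of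
characteristic zero approximated over `𝔽(ε) = RatFunc 𝔽` (the tree's `DDS2021.border` /
`MS2021.IsEpsApprox`), as in the source's Lemma 2.22; the ring-coefficient frame of §3's `Gen(k,s)`
is not addressed.

Honest framing: de-bordering of a restricted read-once class, banked toward the x-rows
`DDS2021_thm_3_2` / `DDS2021_thm_5_1` (which remain OPEN by name); `VP ≠ VNP` is NOT proved and
nothing here bears on it.

## References

* [DuttaDwivediSaxena2022] full version, Lemmas 2.9, 2.10 (p0019 L522 – p0020 L536), 2.22
  (p0024 L644–660), 2.23 (p0025 L661–664); Claim 3.3 (p0027 L724–741).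
* [Nisan1991] N. Nisan, *Lower bounds for non-commutative computation*, STOC 1991, Thm. 1 (tree:
  `BDI20NisanWidthProofs.lean`).
* [BlaserDorflerIkenmeyer2020] Prop. 6.6 / Cor. 6.7 (the same "rank is closed" argument for ncABP
  width; tree `BDI20NcABPWidthClosed.lean`).
-/

noncomputable section

open MvPolynomial
open scoped BigOperators Matrix

namespace Literature.Computability.AlgebraicComplexity

namespace DDS2021

universe u

/-! ## §A Coefficients of a product of univariate polynomials in distinct variables -/

section Box

variable {K : Type*} [CommSemiring K] {n : ℕ}

/-- **A product of univariates, expanded on the box of exponents**: for univariate `G_m` of degree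
`≤ e`, `∏_m G_m(x_m) = Σ_{b ∈ {0..e}^n} (∏_m coeff_{b_m} G_m) · x^b`. [folklore] -/
private theorem prod_aeval_X_eq_sum_box {e : ℕ} (G : Fin n → Polynomial K)
    (hG : ∀ m, (G m).natDegree ≤ e) :
    ∏ m, Polynomial.aeval (X m : MvPolynomial (Fin n) K) (G m) =
      ∑ b : Fin n → Fin (e + 1),
        monomial (Finsupp.equivFunOnFinite.symm fun m => (b m : ℕ)) (∏ m, (G m).coeff (b m)) := by
  classical
  have h1 : ∀ m, Polynomial.aeval (X m : MvPolynomial (Fin n) K) (G m) =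
      ∑ c : Fin (e + 1), C ((G m).coeff c) * X m ^ (c : ℕ) := by
    intro m
    rw [Polynomial.aeval_eq_sum_range' (Nat.lt_succ_of_le (hG m)), Finset.sum_range]
    simp only [smul_eq_C_mul]
  simp_rw [h1]
  rw [Finset.prod_univ_sum, Fintype.piFinset_univ]
  refine Finset.sum_congr rfl fun b _ => ?_
  rw [Finset.prod_mul_distrib, ← map_prod, monomial_eq, Finsupp.prod_fintype _ _ fun i => pow_zero _]
  simp only [Finsupp.coe_equivFunOnFinite_symm]

/-- **The coefficient of `x^a` (`a` in the box) in a product of univariates is the product of the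
coefficients** (the coefficient matrices of a read-once product, as in the proof of Lemma 2.9).
[cite: DuttaDwivediSaxena2022, Lemma 2.9 (full version p0019 L522–531)] -/
theorem coeff_box_prod_aeval_X {e : ℕ} (G : Fin n → Polynomial K) (hG : ∀ m, (G m).natDegree ≤ e)
    (a : Fin n → Fin (e + 1)) :
    coeff (Finsupp.equivFunOnFinite.symm fun m => (a m : ℕ))
        (∏ m, Polynomial.aeval (X m : MvPolynomial (Fin n) K) (G m)) = ∏ m, (G m).coeff (a m) := by
  classical
  rw [prod_aeval_X_eq_sum_box G hG, coeff_sum, Finset.sum_eq_single a]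
  · rw [coeff_monomial, if_pos rfl]
  · intro b _ hb
    rw [coeff_monomial, if_neg]
    intro h
    apply hb
    have h' := congrArg (fun s : Fin n →₀ ℕ => (s : Fin n → ℕ)) h
    simp only [Finsupp.coe_equivFunOnFinite_symm] at h'
    funext m
    exact Fin.ext (congrFun h' m)
  · intro ha
    exact absurd (Finset.mem_univ a) ha

/-- Outside the box every coefficient of a product of univariates of degree `≤ e` vanishes
(individual degree `≤ e`, the hypothesis of Lemmas 2.9/2.10).
[cite: DuttaDwivediSaxena2022, Lemma 2.9 (full version p0019 L522–531)] -/
theorem coeff_prod_aeval_X_eq_zero_of_lt {e : ℕ} (G : Fin n → Polynomial K)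
    (hG : ∀ m, (G m).natDegree ≤ e) (d : Fin n →₀ ℕ) {m₀ : Fin n} (hd : e < d m₀) :
    coeff d (∏ m, Polynomial.aeval (X m : MvPolynomial (Fin n) K) (G m)) = 0 := by
  classical
  rw [prod_aeval_X_eq_sum_box G hG, coeff_sum]
  refine Finset.sum_eq_zero fun b _ => ?_
  rw [coeff_monomial, if_neg]
  intro h
  have h' := congrArg (fun s : Fin n →₀ ℕ => s m₀) h
  simp only [Finsupp.coe_equivFunOnFinite_symm] at h'
  have := (b m₀).2
  omega

/-- The coefficient tensor of a **sum of products of univariates** `Σ_p κ_p ∏_m G_{p,m}(x_m)`: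
`Ψ(a) = Σ_p κ_p ∏_m coeff_{a_m} G_{p,m}` (the coefficient spaces of Lemma 2.9 for the diagonal
read-once program). [cite: DuttaDwivediSaxena2022, Lemma 2.9 (full version p0019 L522–531)] -/
theorem coeff_box_sum_prod_aeval_X {ι : Type*} [Fintype ι] {e : ℕ} (κ : ι → K)
    (G : ι → Fin n → Polynomial K) (hG : ∀ p m, (G p m).natDegree ≤ e) (a : Fin n → Fin (e + 1)) :
    coeff (Finsupp.equivFunOnFinite.symm fun m => (a m : ℕ))
        (∑ p, C (κ p) * ∏ m, Polynomial.aeval (X m : MvPolynomial (Fin n) K) (G p m)) =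
      ∑ p, κ p * ∏ m, (G p m).coeff (a m) := by
  rw [coeff_sum]
  refine Finset.sum_congr rfl fun p _ => ?_
  rw [coeff_C_mul, coeff_box_prod_aeval_X (G p) (hG p) a]

/-- Outside the box every coefficient of a sum of products of univariates of degree `≤ e` vanishes
(individual degree `≤ e`). [cite: DuttaDwivediSaxena2022, Lemma 2.9 (full version p0019 L522–531)] -/
theorem coeff_sum_prod_aeval_X_eq_zero_of_lt {ι : Type*} [Fintype ι] {e : ℕ} (κ : ι → K)
    (G : ι → Fin n → Polynomial K) (hG : ∀ p m, (G p m).natDegree ≤ e) (d : Fin n →₀ ℕ)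
    {m₀ : Fin n} (hd : e < d m₀) :
    coeff d (∑ p, C (κ p) * ∏ m, Polynomial.aeval (X m : MvPolynomial (Fin n) K) (G p m)) = 0 := by
  rw [coeff_sum]
  refine Finset.sum_eq_zero fun p _ => ?_
  rw [coeff_C_mul, coeff_prod_aeval_X_eq_zero_of_lt (G p) (hG p) d hd, mul_zero]

end Box

/-! ## §B The read-once form has transfer matrices of width `T` (Lemma 2.9 direction) -/

section Width

variable {K : Type*} [CommRing K] {n : ℕ}

/-- An ordered product of diagonal matrices is the diagonal matrix of the products. [folklore] -/
private theorem prod_ofFn_diagonal {w : ℕ} (d : Fin n → Fin w → K) :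
    (List.ofFn fun ℓ => Matrix.diagonal (d ℓ)).prod = Matrix.diagonal fun p => ∏ ℓ, d ℓ p := by
  induction n with
  | zero => simp
  | succ n ih =>
    rw [List.ofFn_succ, List.prod_cons, ih, Matrix.diagonal_mul_diagonal]
    congr 1
    funext p
    rw [Fin.prod_univ_succ]

/-- **DDS21 Lemma 2.9 for the read-once form (width bound)**: the coefficient tensor of
`Σ_{p<T} κ_p ∏_m G_{p,m}(x_m)` is computed by the width-`T` noncommutative ABP with DIAGONAL
transfer matrices `C_ℓ[c] = diag_p(coeff_c G_{p,ℓ})`, source vector `κ` and sink vector `1`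
("the dimension of the coefficient space is rightly captured by the width").
[cite: DuttaDwivediSaxena2022, Lemma 2.9 (full version p0019 L522–531)] -/
theorem hasNcABPWidthLE_coeff_sum_prod_univariate {T e : ℕ} (κ : Fin T → K)
    (G : Fin T → Fin n → Polynomial K) (hG : ∀ p m, (G p m).natDegree ≤ e) :
    BDI2020.HasNcABPWidthLE T (fun a : Fin n → Fin (e + 1) =>
      coeff (Finsupp.equivFunOnFinite.symm fun m => (a m : ℕ))
        (∑ p, C (κ p) * ∏ m, Polynomial.aeval (X m : MvPolynomial (Fin n) K) (G p m))) := by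
  classical
  refine ⟨fun ℓ c => Matrix.diagonal fun p => (G p ℓ).coeff c, κ, fun _ => 1, fun a => ?_⟩
  dsimp only
  rw [coeff_box_sum_prod_aeval_X κ G hG a, prod_ofFn_diagonal]
  simp only [dotProduct, Matrix.mulVec_diagonal, mul_one]

/-- Hence **every Nisan flattening of that coefficient tensor has rank `≤ T`** (over a field).
[cite: DuttaDwivediSaxena2022, Lemma 2.9 (full version p0019 L522–531)] -/
theorem rank_wordFlattening_coeff_sum_prod_univariate_le {L : Type*} [Field L] {T e : ℕ}
    (κ : Fin T → L) (G : Fin T → Fin n → Polynomial L) (hG : ∀ p m, (G p m).natDegree ≤ e)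
    (a b : ℕ) (h : a + b = n) :
    (wordFlattening (fun w : Fin n → Fin (e + 1) =>
      coeff (Finsupp.equivFunOnFinite.symm fun m => (w m : ℕ))
        (∑ p, C (κ p) * ∏ m, Polynomial.aeval (X m : MvPolynomial (Fin n) L) (G p m))) a b h).rank
      ≤ T :=
  BDI2020.Nisan.rank_wordFlattening_le_of_hasNcABPWidthLE
    (hasNcABPWidthLE_coeff_sum_prod_univariate κ G hG) a b h

end Width

/-! ## §C The limit step of Lemma 2.22: flattening ranks do not increase under `ε → 0` -/

section Limit

variable {F : Type*} [Field F]

/-- **"The dimension of the coefficient space does not increase under limits"** (proof of DDS21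
Lemma 2.22), in minor form: if a word tensor of POLYNOMIALS in `ε` has, read in `𝔽(ε)`, all
flattenings at a cut of rank `≤ s`, then so does its constant-term tensor — every `(s+1)`-minor
is a polynomial in `ε` vanishing in `𝔽(ε)`, hence vanishing, hence with constant term `0`.
[cite: DuttaDwivediSaxena2022, Lemma 2.22 (full version p0024 L644–660)] -/
theorem rank_wordFlattening_constantCoeff_le {N m s : ℕ} (P : (Fin N → Fin m) → Polynomial F)
    (a b : ℕ) (h : a + b = N)
    (hg : (wordFlattening (fun w => algebraMap (Polynomial F) (RatFunc F) (P w)) a b h).rank ≤ s) :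
    (wordFlattening (fun w => (P w).coeff 0) a b h).rank ≤ s := by
  classical
  rw [Literature.LinearAlgebra.Matrix.rank_le_iff_det_submatrix_eq_zero] at hg ⊢
  intro r c
  have hmapg : wordFlattening (fun w => algebraMap (Polynomial F) (RatFunc F) (P w)) a b h =
      (wordFlattening P a b h).map (algebraMap (Polynomial F) (RatFunc F)) := by
    ext u v; rfl
  have hmapf : wordFlattening (fun w => (P w).coeff 0) a b h =
      (wordFlattening P a b h).map (Polynomial.constantCoeff : Polynomial F →+* F) := by
    ext u v; rfl
  have h1 := hg r c
  rw [hmapg, Matrix.submatrix_map, ← RingHom.mapMatrix_apply, ← RingHom.map_det,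
    map_eq_zero_iff _ (RatFunc.algebraMap_injective F)] at h1
  rw [hmapf, Matrix.submatrix_map, ← RingHom.mapMatrix_apply, ← RingHom.map_det, h1, map_zero]

end Limit

/-! ## §D From transfer matrices for the coefficient tensor to the read-once program for `f` -/

section Transfer

variable {F : Type*} [CommRing F] {n : ℕ}

/-- A polynomial whose support lies in the box `{0..e}^n` is the sum of its box monomials.
[folklore] -/
private theorem eq_sum_box_monomial {e : ℕ} (f : MvPolynomial (Fin n) F)
    (hsupp : ∀ d ∈ f.support, ∀ m, d m ≤ e) :
    f = ∑ a : Fin n → Fin (e + 1), monomial (Finsupp.equivFunOnFinite.symm fun m => (a m : ℕ))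
      (coeff (Finsupp.equivFunOnFinite.symm fun m => (a m : ℕ)) f) := by
  classical
  set β : (Fin n → Fin (e + 1)) → (Fin n →₀ ℕ) :=
    fun a => Finsupp.equivFunOnFinite.symm fun m => (a m : ℕ) with hβ
  have hinj : Function.Injective β := by
    intro a b h
    have h' := congrArg (fun s : Fin n →₀ ℕ => (s : Fin n → ℕ)) h
    simp only [hβ, Finsupp.coe_equivFunOnFinite_symm] at h'
    funext m
    exact Fin.ext (congrFun h' m)
  have hsum : ∑ a : Fin n → Fin (e + 1), monomial (β a) (coeff (β a) f) =
      ∑ d ∈ Finset.univ.image β, monomial d (coeff d f) := by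
    rw [Finset.sum_image fun a _ b _ h => hinj h]
  have hsub : f.support ⊆ Finset.univ.image β := by
    intro d hd
    refine Finset.mem_image.2 ⟨fun m => ⟨d m, Nat.lt_succ_of_le (hsupp d hd m)⟩, Finset.mem_univ _, ?_⟩
    ext m
    simp [hβ]
  change f = ∑ a : Fin n → Fin (e + 1), monomial (β a) (coeff (β a) f)
  rw [hsum, ← Finset.sum_subset hsub fun d _ hd => by
    rw [notMem_support_iff.1 hd, map_zero]]
  exact f.as_sum

/-- **Ordered expansion of a product of sums of matrices**:
`∏_ℓ (Σ_c x_{ℓ,c} • A_{ℓ,c}) = Σ_{a} (∏_ℓ x_{ℓ,a_ℓ}) • ∏_ℓ A_{ℓ,a_ℓ}` (ordered products over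
`ℓ = 0, …, n-1`, scalars central) — the path expansion of a layered program with transfer matrices
`A_{ℓ,c}`, the identity behind Lemma 2.10's construction.
[cite: DuttaDwivediSaxena2022, Lemma 2.10 (full version p0020 L532–536)] -/
theorem prod_ofFn_sum_smul {R : Type*} [CommSemiring R] {w m : ℕ} :
    ∀ {n : ℕ} (x : Fin n → Fin m → R) (A : Fin n → Fin m → Matrix (Fin w) (Fin w) R),
      (List.ofFn fun ℓ => ∑ c, x ℓ c • A ℓ c).prod =
        ∑ a : Fin n → Fin m, (∏ ℓ, x ℓ (a ℓ)) • (List.ofFn fun ℓ => A ℓ (a ℓ)).prod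
  | 0, x, A => by
    rw [List.ofFn_zero, List.prod_nil, Fintype.sum_unique]
    simp
  | n + 1, x, A => by
    rw [List.ofFn_succ, List.prod_cons, prod_ofFn_sum_smul (fun ℓ => x ℓ.succ) (fun ℓ => A ℓ.succ),
      Finset.sum_mul_sum, ← (Fin.consEquiv fun _ => Fin m).sum_comp, Fintype.sum_prod_type]
    refine Finset.sum_congr rfl fun c _ => Finset.sum_congr rfl fun a' _ => ?_
    simp only [Fin.consEquiv_apply]
    rw [Fin.prod_univ_succ, List.ofFn_succ, List.prod_cons]
    simp only [Fin.cons_zero, Fin.cons_succ]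
    rw [Matrix.smul_mul, Matrix.mul_smul, smul_smul]

/-- The entries of the layer matrices `M_ℓ(x_ℓ) = Σ_c x_ℓ^c · C_ℓ[c]` are the univariate polynomials
`Σ_c C_ℓ[c]_{ij} X^c` in `x_ℓ`, of degree `≤ e` (edge labels of the ARO of Lemma 2.10 / Def. 2.5).
[cite: DuttaDwivediSaxena2022, Lemma 2.10 and Def. 2.5 (full version p0020 L532–536, p0017 L468 – p0018 L476)] -/
theorem transferLayer_apply_eq_aeval {e w : ℕ} (Cm : Fin n → Fin (e + 1) → Matrix (Fin w) (Fin w) F)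
    (ℓ : Fin n) (i j : Fin w) :
    (∑ c : Fin (e + 1), (X ℓ ^ (c : ℕ) : MvPolynomial (Fin n) F) •
        (Cm ℓ c).map (C : F →+* MvPolynomial (Fin n) F)) i j =
      Polynomial.aeval (X ℓ : MvPolynomial (Fin n) F)
        (∑ c : Fin (e + 1), Polynomial.monomial (c : ℕ) (Cm ℓ c i j)) ∧
    (∑ c : Fin (e + 1), Polynomial.monomial (c : ℕ) (Cm ℓ c i j) : Polynomial F).natDegree ≤ e := by
  constructor
  · rw [Matrix.sum_apply, map_sum]
    refine Finset.sum_congr rfl fun c _ => ?_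
    rw [Matrix.smul_apply, Matrix.map_apply, Polynomial.aeval_monomial, algebraMap_eq, smul_eq_mul,
      mul_comm]
  · refine Polynomial.natDegree_sum_le_of_forall_le _ _ fun c _ => ?_
    exact (Polynomial.natDegree_monomial_le _).trans (Nat.le_of_lt_succ c.2)

/-- **DDS21 Lemma 2.10 direction, transfer form**: if the coefficient tensor of `f` (support in the
box `{0..e}^n`) is computed by transfer matrices `(C, u, v)` of width `w`, then
`f = uᵀ · M_0(x_0) ⋯ M_{n-1}(x_{n-1}) · v` with `M_ℓ(x_ℓ) = Σ_c x_ℓ^c · C_ℓ[c]` — a width-`w`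
read-once oblivious ABP for `f` ("there exists an ARO of width `w` for `A(x)`").
[cite: DuttaDwivediSaxena2022, Lemma 2.10 (full version p0020 L532–536)] -/
theorem polynomial_eq_transfer_of_coeff {e w : ℕ} {f : MvPolynomial (Fin n) F}
    (hsupp : ∀ d ∈ f.support, ∀ m, d m ≤ e)
    (Cm : Fin n → Fin (e + 1) → Matrix (Fin w) (Fin w) F) (u v : Fin w → F)
    (hΨ : ∀ a : Fin n → Fin (e + 1), coeff (Finsupp.equivFunOnFinite.symm fun m => (a m : ℕ)) f =
      u ⬝ᵥ ((List.ofFn fun ℓ => Cm ℓ (a ℓ)).prod *ᵥ v)) :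
    f = (fun i => C (u i)) ⬝ᵥ ((List.ofFn fun ℓ : Fin n =>
          ∑ c : Fin (e + 1), (X ℓ ^ (c : ℕ) : MvPolynomial (Fin n) F) •
            (Cm ℓ c).map (C : F →+* MvPolynomial (Fin n) F)).prod *ᵥ fun j => C (v j)) := by
  classical
  rw [prod_ofFn_sum_smul, Matrix.sum_mulVec, dotProduct_sum]
  conv_lhs => rw [eq_sum_box_monomial f hsupp]
  refine Finset.sum_congr rfl fun a _ => ?_
  have hmap : (List.ofFn fun ℓ => (Cm ℓ (a ℓ)).map (C : F →+* MvPolynomial (Fin n) F)).prod =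
      ((List.ofFn fun ℓ => Cm ℓ (a ℓ)).prod).map (C : F →+* MvPolynomial (Fin n) F) := by
    rw [← RingHom.mapMatrix_apply, map_list_prod, List.map_ofFn]
    rfl
  have hC : ((fun i => C (u i)) ⬝ᵥ (((List.ofFn fun ℓ => Cm ℓ (a ℓ)).prod).map
      (C : F →+* MvPolynomial (Fin n) F) *ᵥ fun j => C (v j))) =
      C (u ⬝ᵥ ((List.ofFn fun ℓ => Cm ℓ (a ℓ)).prod *ᵥ v)) := by
    rw [RingHom.map_dotProduct]
    have h2 : ((C : F →+* MvPolynomial (Fin n) F) ∘ ((List.ofFn fun ℓ => Cm ℓ (a ℓ)).prod *ᵥ v)) =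
        (((List.ofFn fun ℓ => Cm ℓ (a ℓ)).prod).map (C : F →+* MvPolynomial (Fin n) F) *ᵥ
          fun j => C (v j)) := by
      funext i
      rw [Function.comp_apply, RingHom.map_mulVec]
      rfl
    rw [h2]
    rfl
  rw [Matrix.smul_mulVec, dotProduct_smul, hmap, hC, ← hΨ a, smul_eq_mul, monomial_eq,
    Finsupp.prod_fintype _ _ fun i => pow_zero _, mul_comm]
  simp only [Finsupp.coe_equivFunOnFinite_symm]

end Transfer

/-! ## §E Lemma 2.22 / 2.23 assembled: de-bordering the read-once form -/

section Deborder

variable {F : Type*} [Field F] {n : ℕ}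

/-- **DDS21 Lemma 2.22 (de-bordering ARO) for the explicit read-once input**: if
`g = Σ_{p<T} κ_p ∏_m G_{p,m}(x_m)` over `𝔽(ε)` (a width-`T` diagonal read-once program) approximates
`f ∈ 𝔽[x]` (`MS2021.IsEpsApprox f g`: the coefficients of `g` are polynomials in `ε` with constant
terms those of `f`), then `f` has a width-`T` read-once oblivious program over `𝔽` with univariate
labels of degree `≤ e` in the same order: the transfer matrices come from Nisan's characterisation
(tree `BDI2020.hasNcABPWidthLE_iff_wordTTRank_le`) applied to the coefficient tensor of `f`, whose
flattening ranks are `≤ T` by §B and §C. "The dimension of the coefficient space does not increase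
under limits … by Lemma 2.10 there exists an ARO of width `w`."
[cite: DuttaDwivediSaxena2022, Lemma 2.22 (full version p0024 L644–660)] -/
theorem exists_transfer_of_isEpsApprox_sum_prod_univariate {T e : ℕ} {f : MvPolynomial (Fin n) F}
    (κ : Fin T → RatFunc F) (G : Fin T → Fin n → Polynomial (RatFunc F))
    (hG : ∀ p m, (G p m).natDegree ≤ e)
    (hfg : MS2021.IsEpsApprox f
      (∑ p, C (κ p) * ∏ m, Polynomial.aeval (X m : MvPolynomial (Fin n) (RatFunc F)) (G p m))) :
    ∃ (Cm : Fin n → Fin (e + 1) → Matrix (Fin T) (Fin T) F) (u v : Fin T → F),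
      f = (fun i => C (u i)) ⬝ᵥ ((List.ofFn fun ℓ : Fin n =>
          ∑ c : Fin (e + 1), (X ℓ ^ (c : ℕ) : MvPolynomial (Fin n) F) •
            (Cm ℓ c).map (C : F →+* MvPolynomial (Fin n) F)).prod *ᵥ fun j => C (v j)) := by
  classical
  set g : MvPolynomial (Fin n) (RatFunc F) :=
    ∑ p, C (κ p) * ∏ m, Polynomial.aeval (X m : MvPolynomial (Fin n) (RatFunc F)) (G p m) with hg
  obtain ⟨hle, hcoef⟩ := hfg
  have hcast : (Fin.castLE hle : Fin n → Fin n) = id := funext fun i => Fin.ext rfl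
  have hren : rename (Fin.castLE hle) f = f := by
    rw [hcast]
    exact AlgHom.congr_fun rename_id f
  choose P hP₁ hP₂ using hcoef
  simp only [hren] at hP₂
  -- the support of `f` lies in the box
  have hsupp : ∀ d ∈ f.support, ∀ m, d m ≤ e := by
    intro d hd m
    by_contra hlt
    rw [not_le] at hlt
    have h0 : coeff d g = 0 := coeff_sum_prod_aeval_X_eq_zero_of_lt κ G hG d hlt
    rw [hP₁ d, map_eq_zero_iff _ (RatFunc.algebraMap_injective F)] at h0
    have : coeff d f = 0 := by rw [← hP₂ d, h0, Polynomial.coeff_zero]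
    exact (mem_support_iff.1 hd) this
  -- flattening ranks of the coefficient tensor of `f` are `≤ T`
  set Ψf : (Fin n → Fin (e + 1)) → F :=
    fun a => coeff (Finsupp.equivFunOnFinite.symm fun m => (a m : ℕ)) f with hΨf
  have hrank : ∀ (a b : ℕ) (h : a + b = n), (wordFlattening Ψf a b h).rank ≤ T := by
    intro a b h
    have hPg : (fun w : Fin n → Fin (e + 1) =>
        algebraMap (Polynomial F) (RatFunc F)
          (P (Finsupp.equivFunOnFinite.symm fun m => (w m : ℕ)))) =
        fun w => coeff (Finsupp.equivFunOnFinite.symm fun m => (w m : ℕ)) g := by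
      funext w
      rw [← hP₁]
    have hPf : (fun w : Fin n → Fin (e + 1) =>
        (P (Finsupp.equivFunOnFinite.symm fun m => (w m : ℕ))).coeff 0) = Ψf := by
      funext w
      rw [hP₂]
    rw [← hPf]
    refine rank_wordFlattening_constantCoeff_le _ a b h ?_
    rw [hPg]
    exact rank_wordFlattening_coeff_sum_prod_univariate_le κ G hG a b h
  have hwidth : BDI2020.HasNcABPWidthLE T Ψf :=
    (BDI2020.hasNcABPWidthLE_iff_wordTTRank_le Ψf).2 (wordTTRank_le_iff.2 hrank)
  obtain ⟨Cm, u, v, hΨ⟩ := hwidth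
  exact ⟨Cm, u, v, polynomial_eq_transfer_of_coeff hsupp Cm u v hΨ⟩

/-- **DDS21 Lemma 2.23 for `Σ∧Σ` (de-bordering: `\overline{Σ∧Σ} ⊆ ARO`), transfer form.** Over a
field `𝔽` of characteristic zero: every `f ∈ \overline{Σ∧Σ(t,e)}` (approximated over `𝔽(ε)` by
`Σ∧Σ` circuits of top fan-in `≤ t` and exponents `≤ e`, the tree's `DDS2021.border` /
`DDS2021.swsClass`) is computed EXACTLY by a read-once oblivious ABP over `𝔽` of width
`T = t · ((n+1)e + 1)` in the order `x_0, …, x_{n-1}`, with univariate edge labels of degree `≤ e`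
(`transferLayer_apply_eq_aeval`): `f = uᵀ M_0(x_0) ⋯ M_{n-1}(x_{n-1}) v`. This is the `P/Q` half of
the base step Claim 3.3 ("`\overline{Σ∧Σ} ⊆ ARO`", p0027 L737–741); the print's "ARO of size
`O(s n² D²)`" is this width times the `n + 1` layers. Route: B2's duality step
`exists_sum_prod_univariate_of_mem_swsClass` over `𝔽(ε)`, then
`exists_transfer_of_isEpsApprox_sum_prod_univariate`.
[cite: DuttaDwivediSaxena2022, Lemma 2.23 (full version p0025 L661–664)] -/
theorem exists_transfer_of_mem_border_swsClass [CharZero F] {t e : ℕ} {f : MvPolynomial (Fin n) F}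
    (hf : f ∈ border (swsClass (RatFunc F) n t e)) :
    ∃ (Cm : Fin n → Fin (e + 1) → Matrix (Fin (t * ((n + 1) * e + 1))) (Fin (t * ((n + 1) * e + 1))) F)
      (u v : Fin (t * ((n + 1) * e + 1)) → F),
      f = (fun i => C (u i)) ⬝ᵥ ((List.ofFn fun ℓ : Fin n =>
          ∑ c : Fin (e + 1), (X ℓ ^ (c : ℕ) : MvPolynomial (Fin n) F) •
            (Cm ℓ c).map (C : F →+* MvPolynomial (Fin n) F)).prod *ᵥ fun j => C (v j)) := by
  classical
  obtain ⟨g, hg, hfg⟩ := hf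
  obtain ⟨κ, G, hG, hgsum⟩ := exists_sum_prod_univariate_of_mem_swsClass hg
  set eqv := (finProdFinEquiv : Fin t × Fin ((n + 1) * e + 1) ≃ Fin (t * ((n + 1) * e + 1)))
    with heqv
  have hgsum' : g = ∑ q : Fin (t * ((n + 1) * e + 1)), C (κ (eqv.symm q)) *
      ∏ m, Polynomial.aeval (X m : MvPolynomial (Fin n) (RatFunc F)) (G (eqv.symm q) m) := by
    rw [hgsum]
    exact Fintype.sum_equiv eqv _ _ fun p => by rw [Equiv.symm_apply_apply]
  rw [hgsum'] at hfg
  exact exists_transfer_of_isEpsApprox_sum_prod_univariate (fun q => κ (eqv.symm q))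
    (fun q => G (eqv.symm q)) (fun q m => hG _ m) hfg

end Deborder

/-! ## §F In the tree's ABP currency: `\overline{Σ∧Σ} ⊆ ABP` (v2 append) -/

section ABP

variable {F : Type*} [CommSemiring F] {n : ℕ}

/-- Partial products of the layer matrices: `take (k+1) = take k * M_k` for `k < n`. [folklore] -/
private theorem prod_take_succ_ofFn {w : ℕ} (M : Fin n → Matrix (Fin w) (Fin w) (MvPolynomial (Fin n) F))
    (k : ℕ) (hk : k < n) :
    ((List.ofFn M).take (k + 1)).prod = ((List.ofFn M).take k).prod * M ⟨k, hk⟩ := by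
  rw [List.take_add_one, List.prod_append, List.getElem?_ofFn, dif_pos hk, Option.toList_some,
    List.prod_singleton]

/-- **Transfer-matrix (read-once / IMM-type) programs are layered ABPs with univariate labels**: for
vectors `u, v ∈ F^w` and layer matrices `M_0, …, M_{n-1}` (`w × w`, entries univariate of degree
`≤ S`), the polynomial `uᵀ M_0 ⋯ M_{n-1} v` has a `UABPComputesLen S (n+2)` witness on the
`(n+1)·w + 2` vertices `source`, `(ℓ, i)` (`ℓ ≤ n`, `i < w`), `sink` — ONE shared layered DAG
(edges `source → (0,i)` labelled `u_i`, `(ℓ,i) → (ℓ+1,j)` labelled `(M_ℓ)_{ij}`, `(n,j) → sink`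
labelled `v_j`), as in the source's "sum-of-product-of-univariates … is subsumed by ARO" and Def. 2.5.
[cite: DuttaDwivediSaxena2022, Def. 2.5 and Lemma 2.17 (full version p0017 L468 – p0018 L476, p0022 L593–603)] -/
theorem UABPComputesLen.of_transferMatrices {w S : ℕ} (u v : Fin w → F)
    (M : Fin n → Matrix (Fin w) (Fin w) (MvPolynomial (Fin n) F))
    (hlab : ∀ ℓ i j, (M ℓ i j).vars.card ≤ 1 ∧ (M ℓ i j).totalDegree ≤ S)
    (hS : (n + 1) * w + 2 ≤ S) :
    UABPComputesLen S (n + 2)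
      ((fun i => C (u i)) ⬝ᵥ ((List.ofFn M).prod *ᵥ fun j => C (v j))) := by
  classical
  -- the layered adjacency matrix on `Bool ⊕ (Fin (n+1) × Fin w)` (`inl false` = source, `inl true` = sink)
  obtain ⟨N, hN⟩ : ∃ N : Matrix (Bool ⊕ (Fin (n + 1) × Fin w)) (Bool ⊕ (Fin (n + 1) × Fin w))
      (MvPolynomial (Fin n) F), N = fun p q => match p, q with
      | Sum.inl false, Sum.inr (ℓ, i) => if (ℓ : ℕ) = 0 then C (u i) else 0
      | Sum.inr (ℓ, i), Sum.inr (ℓ', j) =>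
          if h : (ℓ : ℕ) + 1 = ℓ' then M ⟨ℓ, by have := ℓ'.2; omega⟩ i j else 0
      | Sum.inr (ℓ, j), Sum.inl true => if (ℓ : ℕ) = n then C (v j) else 0
      | _, _ => 0 := ⟨_, rfl⟩
  let layer : Bool ⊕ (Fin (n + 1) × Fin w) → ℕ := fun p => match p with
      | Sum.inl false => 0
      | Sum.inl true => n + 2
      | Sum.inr (ℓ, _) => (ℓ : ℕ) + 1
  have hN_src : ∀ q, N q (Sum.inl false) = 0 := by
    rintro (b | ⟨ℓ, i⟩)
    · cases b <;> simp [hN]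
    · simp [hN]
  have hN_ll : ∀ b b' : Bool, N (Sum.inl b) (Sum.inl b') = 0 := by
    rintro (_ | _) (_ | _) <;> simp [hN]
  have hN_lr : ∀ (b : Bool) (ℓ : Fin (n + 1)) (i : Fin w),
      N (Sum.inl b) (Sum.inr (ℓ, i)) = if b = false ∧ (ℓ : ℕ) = 0 then C (u i) else 0 := by
    rintro (_ | _) ℓ i <;> simp [hN]
  have hN_rr : ∀ (ℓ ℓ' : Fin (n + 1)) (i j : Fin w),
      N (Sum.inr (ℓ, i)) (Sum.inr (ℓ', j)) =
        if h : (ℓ : ℕ) + 1 = ℓ' then M ⟨ℓ, by have := ℓ'.2; omega⟩ i j else 0 := by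
    intro ℓ ℓ' i j; simp [hN]
  have hN_rt : ∀ (ℓ : Fin (n + 1)) (j : Fin w),
      N (Sum.inr (ℓ, j)) (Sum.inl true) = if (ℓ : ℕ) = n then C (v j) else 0 := by
    intro ℓ j; simp [hN]
  -- one step of the power: row of the source
  have hstep : ∀ (k : ℕ) (x : Bool ⊕ (Fin (n + 1) × Fin w)),
      (N ^ (k + 1)) (Sum.inl false) x = ∑ y, (N ^ k) (Sum.inl false) y * N y x := by
    intro k x
    rw [pow_succ, Matrix.mul_apply]
  -- the row of the source after `k + 1` steps, `k ≤ n`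
  have hrow : ∀ k : ℕ, k ≤ n →
      (∀ b, (N ^ (k + 1)) (Sum.inl false) (Sum.inl b) = 0) ∧
      ∀ (ℓ : Fin (n + 1)) (j : Fin w), (N ^ (k + 1)) (Sum.inl false) (Sum.inr (ℓ, j)) =
        if (ℓ : ℕ) = k then ((fun i => C (u i)) ᵥ* ((List.ofFn M).take k).prod) j else 0 := by
    intro k
    induction k with
    | zero =>
      intro _
      refine ⟨fun b => ?_, fun ℓ j => ?_⟩
      · rw [pow_one, hN_ll]
      · rw [pow_one, List.take_zero, List.prod_nil, Matrix.vecMul_one, hN_lr]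
        simp only [true_and]
    | succ k ih =>
      intro hk
      obtain ⟨ih1, ih2⟩ := ih (Nat.le_of_succ_le hk)
      have hkn : k < n := hk
      -- the sum over the predecessor layer collapses to `ℓ = k`
      have hsum : ∀ x, (N ^ (k + 1 + 1)) (Sum.inl false) x =
          ∑ i : Fin w, ((fun i => C (u i)) ᵥ* ((List.ofFn M).take k).prod) i *
            N (Sum.inr (⟨k, by omega⟩, i)) x := by
        intro x
        rw [hstep, Fintype.sum_sum_type]
        simp only [ih1, zero_mul, Finset.sum_const_zero, zero_add]
        rw [Fintype.sum_prod_type, Finset.sum_eq_single (⟨k, by omega⟩ : Fin (n + 1))]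
        · refine Finset.sum_congr rfl fun i _ => ?_
          rw [ih2, if_pos rfl]
        · intro ℓ _ hℓ
          refine Finset.sum_eq_zero fun i _ => ?_
          rw [ih2, if_neg, zero_mul]
          exact fun h => hℓ (Fin.ext h)
        · intro h; exact absurd (Finset.mem_univ _) h
      refine ⟨fun b => ?_, fun ℓ' j => ?_⟩
      · rw [hsum]
        refine Finset.sum_eq_zero fun i _ => ?_
        cases b
        · rw [hN_src, mul_zero]
        · rw [hN_rt, if_neg (by simp; omega), mul_zero]
      · rw [hsum]
        by_cases hℓ' : (ℓ' : ℕ) = k + 1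
        · rw [if_pos hℓ']
          have hM : ∀ i, N (Sum.inr (⟨k, by omega⟩, i)) (Sum.inr (ℓ', j)) = M ⟨k, hkn⟩ i j := by
            intro i
            rw [hN_rr, dif_pos (by simp [hℓ'])]
          simp_rw [hM]
          rw [prod_take_succ_ofFn M k hkn, ← Matrix.vecMul_vecMul]
          rfl
        · rw [if_neg hℓ']
          refine Finset.sum_eq_zero fun i _ => ?_
          rw [hN_rr, dif_neg (by simp; omega), mul_zero]
  -- assemble the witness
  refine UABPComputesLen.of_fintype (ι := Bool ⊕ (Fin (n + 1) × Fin w)) (by simp; omega) layer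
    (Sum.inl false) (Sum.inl true) N ?_ ?_ (by simp [layer]) ?_
  · -- every edge goes one layer up
    rintro (b | ⟨ℓ, i⟩) (b' | ⟨ℓ', j⟩) h
    · exact absurd (hN_ll b b') h
    · rw [hN_lr] at h
      cases b
      · simp only [true_and, ne_eq, ite_eq_right_iff, Classical.not_imp] at h
        simp [layer, h.1]
      · simp at h
    · cases b'
      · exact absurd (hN_src _) h
      · rw [hN_rt] at h
        simp only [ne_eq, ite_eq_right_iff, Classical.not_imp] at h
        simp [layer, h.1]
    · rw [hN_rr] at h
      simp only [ne_eq, dite_eq_right_iff, not_forall] at h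
      obtain ⟨h1, -⟩ := h
      simp [layer, ← h1]
  · -- labels are univariate of degree `≤ S`
    rintro (b | ⟨ℓ, i⟩) (b' | ⟨ℓ', j⟩)
    · rw [hN_ll]; simp
    · rw [hN_lr]
      split_ifs <;> simp [vars_C]
    · cases b'
      · rw [hN_src]; simp
      · rw [hN_rt]
        split_ifs <;> simp [vars_C]
    · rw [hN_rr]
      split_ifs
      · exact hlab _ _ _
      · simp
  · -- the computed polynomial
    obtain ⟨-, hlast⟩ := hrow n le_rfl
    rw [show n + 2 = n + 1 + 1 from rfl, hstep, Fintype.sum_sum_type]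
    have h0 : ∀ b, (N ^ (n + 1)) (Sum.inl false) (Sum.inl b) = 0 := (hrow n le_rfl).1
    simp only [h0, zero_mul, Finset.sum_const_zero, zero_add]
    rw [Fintype.sum_prod_type, Finset.sum_eq_single (Fin.last n)]
    · rw [Matrix.dotProduct_mulVec]
      have htake : (List.ofFn M).take n = List.ofFn M :=
        List.take_of_length_le (by rw [List.length_ofFn])
      simp only [hlast, Fin.val_last, if_true, htake, hN_rt]
      rfl
    · intro ℓ _ hℓ
      refine Finset.sum_eq_zero fun j _ => ?_
      rw [hN_rt, if_neg (fun h => hℓ (Fin.ext (by simp [h]))), mul_zero]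
    · intro h; exact absurd (Finset.mem_univ _) h

end ABP

section ABPDeborder

variable {F : Type*} [Field F] {n : ℕ}

/-- The layer matrices `M_ℓ(x_ℓ) = Σ_c x_ℓ^c · C_ℓ[c]` have univariate entries of degree `≤ e`
(`vars.card ≤ 1`, `totalDegree ≤ e`), i.e. admissible edge labels of DDS Def. 2.5.
[cite: DuttaDwivediSaxena2022, Def. 2.5 (full version p0017 L468 – p0018 L476)] -/
theorem transferLayer_label {e w : ℕ} (Cm : Fin n → Fin (e + 1) → Matrix (Fin w) (Fin w) F)
    (ℓ : Fin n) (i j : Fin w) :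
    ((∑ c : Fin (e + 1), (X ℓ ^ (c : ℕ) : MvPolynomial (Fin n) F) •
        (Cm ℓ c).map (C : F →+* MvPolynomial (Fin n) F)) i j).vars.card ≤ 1 ∧
    ((∑ c : Fin (e + 1), (X ℓ ^ (c : ℕ) : MvPolynomial (Fin n) F) •
        (Cm ℓ c).map (C : F →+* MvPolynomial (Fin n) F)) i j).totalDegree ≤ e := by
  classical
  obtain ⟨h1, h2⟩ := transferLayer_apply_eq_aeval Cm ℓ i j
  rw [h1]
  exact ⟨(Finset.card_le_card (vars_aeval_X_subset ℓ _)).trans (by simp),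
    totalDegree_aeval_X_le ℓ h2⟩

/-- **DDS21 Lemma 2.22 in the tree's ABP currency** (explicit diagonal read-once input): if
`g = Σ_{p<T} κ_p ∏_m G_{p,m}(x_m)` over `𝔽(ε)` approximates `f`, then
`DDS2021.UABPComputes ((n+1)·T + e + 2) f` over `𝔽` — the read-once program of
`exists_transfer_of_isEpsApprox_sum_prod_univariate` realised as ONE layered DAG
(`UABPComputesLen.of_transferMatrices`). [cite: DuttaDwivediSaxena2022, Lemma 2.22 (full version p0024 L644–660)] -/
theorem uabpComputes_of_isEpsApprox_sum_prod_univariate {T e : ℕ} {f : MvPolynomial (Fin n) F}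
    (κ : Fin T → RatFunc F) (G : Fin T → Fin n → Polynomial (RatFunc F))
    (hG : ∀ p m, (G p m).natDegree ≤ e)
    (hfg : MS2021.IsEpsApprox f
      (∑ p, C (κ p) * ∏ m, Polynomial.aeval (X m : MvPolynomial (Fin n) (RatFunc F)) (G p m))) :
    UABPComputes ((n + 1) * T + e + 2) f := by
  obtain ⟨Cm, u, v, hf⟩ := exists_transfer_of_isEpsApprox_sum_prod_univariate κ G hG hfg
  rw [hf]
  exact (UABPComputesLen.of_transferMatrices u v _
    (fun ℓ i j => ⟨(transferLayer_label Cm ℓ i j).1,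
      (transferLayer_label Cm ℓ i j).2.trans (by omega)⟩) (by omega)).uabpComputes

/-- **DDS21 Lemma 2.23 for `Σ∧Σ` in the tree's ABP currency: `\overline{Σ∧Σ} ⊆ ABP`.** Over a field
`𝔽` of characteristic zero, every `f ∈ border (swsClass (RatFunc 𝔽) n t e)` — a limit of `Σ∧Σ`
circuits of top fan-in `≤ t` and exponents `≤ e` over `𝔽(ε)` — is computed EXACTLY by a layered
ABP with univariate labels over `𝔽`, `DDS2021.UABPComputes ((n+1) · t((n+1)e+1) + e + 2) f`
(print: "an ARO of size `O(s n² D²)`"; here `(n+1)` layers of width `t((n+1)e+1)` plus source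
and sink). This is the `P/Q` half of the base step Claim 3.3 of the proof of Thm. 3.2
("`\overline{Σ∧Σ} ⊆ ARO … ⊆ ABP`", p0027 L737–741); Thm. 3.2 itself (`DDS2021_thm_3_2`) is NOT
proved here. [cite: DuttaDwivediSaxena2022, Lemma 2.23 (full version p0025 L661–664)] -/
theorem uabpComputes_of_mem_border_swsClass [CharZero F] {t e : ℕ} {f : MvPolynomial (Fin n) F}
    (hf : f ∈ border (swsClass (RatFunc F) n t e)) :
    UABPComputes ((n + 1) * (t * ((n + 1) * e + 1)) + e + 2) f := by
  obtain ⟨Cm, u, v, hf'⟩ := exists_transfer_of_mem_border_swsClass hf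
  rw [hf']
  exact (UABPComputesLen.of_transferMatrices u v _
    (fun ℓ i j => ⟨(transferLayer_label Cm ℓ i j).1,
      (transferLayer_label Cm ℓ i j).2.trans (by omega)⟩) (by omega)).uabpComputes

/-- `uabpComputes_of_isEpsApprox_sum_prod_univariate` with the LENGTH kept: `n + 2` layers
(source, `n + 1` matrix layers, sink). [cite: DuttaDwivediSaxena2022, Lemma 2.22 (full version p0024 L644–660)] -/
theorem uabpComputesLen_of_isEpsApprox_sum_prod_univariate {T e : ℕ} {f : MvPolynomial (Fin n) F}
    (κ : Fin T → RatFunc F) (G : Fin T → Fin n → Polynomial (RatFunc F))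
    (hG : ∀ p m, (G p m).natDegree ≤ e)
    (hfg : MS2021.IsEpsApprox f
      (∑ p, C (κ p) * ∏ m, Polynomial.aeval (X m : MvPolynomial (Fin n) (RatFunc F)) (G p m))) :
    UABPComputesLen ((n + 1) * T + e + 2) (n + 2) f := by
  obtain ⟨Cm, u, v, hf⟩ := exists_transfer_of_isEpsApprox_sum_prod_univariate κ G hG hfg
  rw [hf]
  exact UABPComputesLen.of_transferMatrices u v _
    (fun ℓ i j => ⟨(transferLayer_label Cm ℓ i j).1,
      (transferLayer_label Cm ℓ i j).2.trans (by omega)⟩) (by omega)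

/-- **`\overline{Σ∧Σ} ⊆ ABP` with the LENGTH kept** (for the degree bookkeeping of DiDIL):
`f ∈ border (swsClass (RatFunc 𝔽) n t e) ⇒ UABPComputesLen ((n+1)·t((n+1)e+1) + e + 2) (n+2) f`.
[cite: DuttaDwivediSaxena2022, Lemma 2.23 (full version p0025 L661–664)] -/
theorem uabpComputesLen_of_mem_border_swsClass [CharZero F] {t e : ℕ} {f : MvPolynomial (Fin n) F}
    (hf : f ∈ border (swsClass (RatFunc F) n t e)) :
    UABPComputesLen ((n + 1) * (t * ((n + 1) * e + 1)) + e + 2) (n + 2) f := by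
  obtain ⟨Cm, u, v, hf'⟩ := exists_transfer_of_mem_border_swsClass hf
  rw [hf']
  exact UABPComputesLen.of_transferMatrices u v _
    (fun ℓ i j => ⟨(transferLayer_label Cm ℓ i j).1,
      (transferLayer_label Cm ℓ i j).2.trans (by omega)⟩) (by omega)

/-- One-parameter form of `\overline{Σ∧Σ} ⊆ ABP` ("ARO of size `O(s n² D²)`", Lemma 2.23), in the
binder shape of the tree's `DDS2021_thm_3_2` (`t, e, n ≤ s`, `2 ≤ s`):
`f ∈ border (swsClass (RatFunc 𝔽) n t e) ⇒ UABPComputesLen (s⁷) (n+2) f`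
(`(n+1)·t·((n+1)e+1) + e + 2 ≤ 4s⁴ + 2s² + s + 2 ≤ 8s⁴ ≤ s⁷`; crude, the exponent is immaterial).
[cite: DuttaDwivediSaxena2022, Lemma 2.23 (full version p0025 L661–664)] -/
theorem uabpComputesLen_of_mem_border_swsClass_le [CharZero F] {t e s : ℕ}
    {f : MvPolynomial (Fin n) F} (hf : f ∈ border (swsClass (RatFunc F) n t e))
    (ht : t ≤ s) (he : e ≤ s) (hn : n ≤ s) (hs : 2 ≤ s) :
    UABPComputesLen (s ^ 7) (n + 2) f := by
  refine (uabpComputesLen_of_mem_border_swsClass hf).mono ?_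
  have hn1 : n + 1 ≤ 2 * s := by omega
  have h1 : (n + 1) * (t * ((n + 1) * e + 1)) ≤ 2 * s * (s * (2 * s * s + 1)) :=
    Nat.mul_le_mul hn1 (Nat.mul_le_mul ht (Nat.succ_le_succ (Nat.mul_le_mul hn1 he)))
  have h2 : 2 * s * (s * (2 * s * s + 1)) = 4 * (s * s * (s * s)) + 2 * (s * s) := by ring
  have hp2 : 4 ≤ s * s := Nat.mul_le_mul hs hs
  have hp2' : 2 * s ≤ s * s := Nat.mul_le_mul_right s hs
  have hp4 : 4 * (s * s) ≤ s * s * (s * s) := Nat.mul_le_mul_right (s * s) hp2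
  have h8 : 8 * (s * s * (s * s)) ≤ s ^ 7 :=
    calc 8 * (s * s * (s * s)) ≤ s * s * s * (s * s * (s * s)) :=
          Nat.mul_le_mul_right _ (Nat.mul_le_mul hp2 hs)
      _ = s ^ 7 := by ring
  omega

/-- One-parameter form without the length. [cite: DuttaDwivediSaxena2022, Lemma 2.23 (full version p0025 L661–664)] -/
theorem uabpComputes_of_mem_border_swsClass_le [CharZero F] {t e s : ℕ}
    {f : MvPolynomial (Fin n) F} (hf : f ∈ border (swsClass (RatFunc F) n t e))
    (ht : t ≤ s) (he : e ≤ s) (hn : n ≤ s) (hs : 2 ≤ s) :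
    UABPComputes (s ^ 7) f :=
  (uabpComputesLen_of_mem_border_swsClass_le hf ht he hn hs).uabpComputes

end ABPDeborder

end DDS2021

end Literature.Computability.AlgebraicComplexity

end
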